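import Summits.Ventures.LatticeQCDFlow.Exactness.IMHCommonRandomNumbers
import HarnessLib

/-!
# Common random numbers for TWO TARGETS (sensitivity runs): two flow-MCMC chains with different weights but the same
# proposals and uniforms sit on one common configuration, at every time, with probability at least the overlap
# `∫ min(A₁π₁, A₂π₂)`

HONEST FRAMING: exact (Metropolis-corrected) sampling algorithms for lattice gauge theory;
figures of merit are autocorrelation/cost numbers at stated couplings and volumes; no
continuum-physics claim.

Venture `LatticeQCDFlow` (cell pub-lqcd), topic `Exactness`; FANOUT row 30 (lean-1, GEN-36).  NEW WORK of the
cell, general state space.  A practitioner estimating a finite difference `π₂(f) − π₁(f)` (two couplings, two actions,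
a reweighting check) runs the two exact samplers `K₁ = indepMH q w₁`, `K₂ = indepMH q w₂` — SAME proposal `q`,
different weights, modes `x₁`, `x₂`, constants `Aᵢ = 1/wᵢ(xᵢ)` — on the SAME proposals and uniforms.  Def-free: a CRN
TWO-TARGET KERNEL is any Markov kernel `K̂` on `Ω × Ω` with
`K̂(x, x′) = (q ⊗ U[0,1]) ∘ ((y, u) ↦ (φ¹_x(y, u), φ²_{x′}(y, u)))⁻¹`, `φⁱ_x(y, u) = y` iff `u·wᵢ(x) ≤ wᵢ(y)`;
**`exists_crnTwoTargetKernel`** — one exists.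

* §1 **`crnTwoTarget_map_fst`**, **`crnTwoTarget_map_snd`** — the coordinates move by `K₁` and `K₂` (each run is
  exact for ITS target); **`crnTwoTarget_ge_overlap`** — `K̂(z, C) ≥ ν{y : (y, y) ∈ C}` for every pair `z` and
  measurable `C`, with the OVERLAP MEASURE `ν = min(A₁w₁, A₂w₂)·q = min(A₁π₁, A₂π₂)`: whenever
  `u ≤ min(w₁(y)/w₁(x₁), w₂(y)/w₂(x₂))` both runs accept the common proposal.
* §2 **`bind_crnTwoTarget_ge_overlap`** — AT EVERY TIME `n ≥ 1`, from every joint law of the two current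
  configurations: `P(Ẑ_n ∈ C) ≥ ν{y : (y, y) ∈ C}`; **`bind_crnTwoTarget_observable_eq_ge`** — for every measurable
  observable `g`: `P(g(X_n) = g(X′_n)) ≥ ν(Ω) = ∫ min(A₁w₁, A₂w₂) dq` (diagonal-free);
  **`bind_crnTwoTarget_diagonal_ge`** (`MeasurableEq Ω`) — `P(X_n = X′_n) ≥ ν(Ω)`;
  **`integral_bind_crnTwoTarget_abs_sub_le`** — for `a ≤ g ≤ c`: `E|g(X_n) − g(X′_n)| ≤ (1 − ν(Ω))·(c − a)` — the
  common-random-numbers finite-difference estimator reads the two targets on the SAME configuration with probability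
  at least the overlap, at every time; its spread is at most `(1 − overlap) ×` the range (two independent runs:
  up to the full range).
Reading (gauge files): two exact gauge samplers at neighbouring couplings fed one stream of autoregressive proposals and
uniforms coincide at any given time with probability at least `∫ min(A_β π_β, A_{β′} π_{β′})`.
NOT CLAIMED: accumulation over time (unlike one target, the merged pair can split again: no invariant diagonal law);
any value of the overlap; anything when the two runs use different proposals.  No `sorry`, no new definitions,
nothing cited as a fact.
-/

noncomputable section

namespace Summit.Ventures.LatticeQCDFlow.Exactness

open MeasureTheory ProbabilityTheory Function Set
open scoped ENNReal unitInterval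

variable {Ω : Type*} [MeasurableSpace Ω] {q : Measure Ω} [IsProbabilityMeasure q] {w₁ w₂ : Ω → ℝ}

/-! ## §1 The two-target kernel -/

omit [IsProbabilityMeasure q] in
/-- Joint measurability of the two-target CRN update. [ours] -/
theorem measurable_crnTwoTargetUpdate (hw₁ : Measurable w₁) (hw₂ : Measurable w₂) :
    Measurable (fun zp : (Ω × Ω) × (Ω × unitInterval) =>
      ((if (zp.2.2 : ℝ) * w₁ zp.1.1 ≤ w₁ zp.2.1 then zp.2.1 else zp.1.1),
        (if (zp.2.2 : ℝ) * w₂ zp.1.2 ≤ w₂ zp.2.1 then zp.2.1 else zp.1.2))) := by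
  have hu : Measurable (fun zp : (Ω × Ω) × (Ω × unitInterval) => (zp.2.2 : ℝ)) :=
    measurable_subtype_coe.comp (measurable_snd.comp measurable_snd)
  refine Measurable.prodMk ?_ ?_
  · exact Measurable.ite (measurableSet_le (hu.mul (hw₁.comp (measurable_fst.comp measurable_fst)))
      (hw₁.comp (measurable_fst.comp measurable_snd))) (measurable_fst.comp measurable_snd)
      (measurable_fst.comp measurable_fst)
  · exact Measurable.ite (measurableSet_le (hu.mul (hw₂.comp (measurable_snd.comp measurable_fst)))
      (hw₂.comp (measurable_fst.comp measurable_snd))) (measurable_fst.comp measurable_snd)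
      (measurable_snd.comp measurable_fst)

omit [IsProbabilityMeasure q] in
/-- For a fixed pair, measurability of `(y, u) ↦ (φ¹_x(y, u), φ²_{x′}(y, u))`. [ours] -/
theorem measurable_crnTwoTargetUpdate_apply (hw₁ : Measurable w₁) (hw₂ : Measurable w₂) (z : Ω × Ω) :
    Measurable (fun p : Ω × unitInterval =>
      ((if (p.2 : ℝ) * w₁ z.1 ≤ w₁ p.1 then p.1 else z.1), (if (p.2 : ℝ) * w₂ z.2 ≤ w₂ p.1 then p.1 else z.2))) :=
  (measurable_crnUpdate hw₁ z.1).prodMk (measurable_crnUpdate hw₂ z.2)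

/-- **A CRN two-target kernel exists** (and is Markov). [ours] -/
theorem exists_crnTwoTargetKernel (hw₁ : Measurable w₁) (hw₂ : Measurable w₂) :
    ∃ Khat : Kernel (Ω × Ω) (Ω × Ω), IsMarkovKernel Khat ∧ ∀ z : Ω × Ω,
      Khat z = (q.prod (volume : Measure unitInterval)).map (fun p : Ω × unitInterval =>
        ((if (p.2 : ℝ) * w₁ z.1 ≤ w₁ p.1 then p.1 else z.1), (if (p.2 : ℝ) * w₂ z.2 ≤ w₂ p.1 then p.1 else z.2))) := by
  refine ⟨Kernel.map ((Kernel.deterministic id measurable_id) ×ₖ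
      (Kernel.const (Ω × Ω) (q.prod (volume : Measure unitInterval))))
      (fun zp : (Ω × Ω) × (Ω × unitInterval) =>
        ((if (zp.2.2 : ℝ) * w₁ zp.1.1 ≤ w₁ zp.2.1 then zp.2.1 else zp.1.1),
          (if (zp.2.2 : ℝ) * w₂ zp.1.2 ≤ w₂ zp.2.1 then zp.2.1 else zp.1.2))), ?_, fun z => ?_⟩
  · exact Kernel.IsMarkovKernel.map _ (measurable_crnTwoTargetUpdate hw₁ hw₂)
  · rw [Kernel.map_apply _ (measurable_crnTwoTargetUpdate hw₁ hw₂), Kernel.prod_apply, Kernel.deterministic_apply,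
      Kernel.const_apply, Measure.dirac_prod,
      Measure.map_map (measurable_crnTwoTargetUpdate hw₁ hw₂) measurable_prodMk_left]
    rfl

/-- **THE FIRST RUN IS EXACT FOR THE FIRST TARGET**: `K̂(x, x′)∘fst⁻¹ = indepMH q w₁ x`. [ours] -/
theorem crnTwoTarget_map_fst (hw₁ : Measurable w₁) (hw₂ : Measurable w₂) (hw₁0 : ∀ y, 0 < w₁ y)
    (Khat : Kernel (Ω × Ω) (Ω × Ω))
    (hK : ∀ z : Ω × Ω, Khat z = (q.prod (volume : Measure unitInterval)).map (fun p : Ω × unitInterval =>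
      ((if (p.2 : ℝ) * w₁ z.1 ≤ w₁ p.1 then p.1 else z.1), (if (p.2 : ℝ) * w₂ z.2 ≤ w₂ p.1 then p.1 else z.2))))
    (z : Ω × Ω) : (Khat z).map Prod.fst = indepMH q w₁ z.1 := by
  rw [hK z, Measure.map_map measurable_fst (measurable_crnTwoTargetUpdate_apply hw₁ hw₂ z)]
  exact map_crnUpdate_eq_indepMH hw₁ hw₁0 z.1

/-- **THE SECOND RUN IS EXACT FOR THE SECOND TARGET**: `K̂(x, x′)∘snd⁻¹ = indepMH q w₂ x′`. [ours] -/
theorem crnTwoTarget_map_snd (hw₁ : Measurable w₁) (hw₂ : Measurable w₂) (hw₂0 : ∀ y, 0 < w₂ y)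
    (Khat : Kernel (Ω × Ω) (Ω × Ω))
    (hK : ∀ z : Ω × Ω, Khat z = (q.prod (volume : Measure unitInterval)).map (fun p : Ω × unitInterval =>
      ((if (p.2 : ℝ) * w₁ z.1 ≤ w₁ p.1 then p.1 else z.1), (if (p.2 : ℝ) * w₂ z.2 ≤ w₂ p.1 then p.1 else z.2))))
    (z : Ω × Ω) : (Khat z).map Prod.snd = indepMH q w₂ z.2 := by
  rw [hK z, Measure.map_map measurable_snd (measurable_crnTwoTargetUpdate_apply hw₁ hw₂ z)]
  exact map_crnUpdate_eq_indepMH hw₂ hw₂0 z.2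

omit [IsProbabilityMeasure q] in
/-- Measurability of the overlap density `min(w₁/w₁(x₁), w₂/w₂(x₂))`. [ours, bookkeeping] -/
theorem measurable_overlapDensity (hw₁ : Measurable w₁) (hw₂ : Measurable w₂) (x₁ x₂ : Ω) :
    Measurable (fun y => ENNReal.ofReal (min (w₁ y / w₁ x₁) (w₂ y / w₂ x₂))) :=
  ((hw₁.div_const _).min (hw₂.div_const _)).ennreal_ofReal

omit [IsProbabilityMeasure q] in
/-- **THE OVERLAP MINORISATION.**  `w₁, w₂` measurable and positive, maximal at `x₁` resp. `x₂`.  For every pair `z` and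
measurable `C ⊆ Ω × Ω`: `ν{y : (y, y) ∈ C} ≤ K̂(z, C)` with `ν = min(w₁/w₁(x₁), w₂/w₂(x₂))·q = min(A₁π₁, A₂π₂)` —
whenever `u ≤ min(w₁(y)/w₁(x₁), w₂(y)/w₂(x₂))` both runs accept the common proposal `y`. [ours] -/
theorem crnTwoTarget_ge_overlap (hw₁ : Measurable w₁) (hw₂ : Measurable w₂) (hw₁0 : ∀ y, 0 < w₁ y)
    (hw₂0 : ∀ y, 0 < w₂ y) {x₁ x₂ : Ω} (hmax₁ : ∀ y, w₁ y ≤ w₁ x₁) (hmax₂ : ∀ y, w₂ y ≤ w₂ x₂)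
    (Khat : Kernel (Ω × Ω) (Ω × Ω))
    (hK : ∀ z : Ω × Ω, Khat z = (q.prod (volume : Measure unitInterval)).map (fun p : Ω × unitInterval =>
      ((if (p.2 : ℝ) * w₁ z.1 ≤ w₁ p.1 then p.1 else z.1), (if (p.2 : ℝ) * w₂ z.2 ≤ w₂ p.1 then p.1 else z.2))))
    (z : Ω × Ω) {C : Set (Ω × Ω)} (hC : MeasurableSet C) :
    (q.withDensity fun y => ENNReal.ofReal (min (w₁ y / w₁ x₁) (w₂ y / w₂ x₂))) {y | (y, y) ∈ C} ≤ Khat z C := by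
  have hdiag : Measurable (fun y : Ω => (y, y)) := measurable_id.prodMk measurable_id
  have hD : MeasurableSet {y : Ω | (y, y) ∈ C} := hdiag hC
  have hW₁ : 0 < w₁ x₁ := hw₁0 x₁
  have hW₂ : 0 < w₂ x₂ := hw₂0 x₂
  rw [hK z, Measure.map_apply (measurable_crnTwoTargetUpdate_apply hw₁ hw₂ z) hC,
    Measure.prod_apply ((measurable_crnTwoTargetUpdate_apply hw₁ hw₂ z) hC), withDensity_apply _ hD,
    ← lintegral_indicator hD]
  refine lintegral_mono fun y => ?_
  by_cases hy : y ∈ {y | (y, y) ∈ C}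
  · rw [indicator_of_mem hy]
    -- the `u`-interval `{u ≤ min(…)}` is contained in the section, and has the displayed volume
    have hm0 : 0 ≤ min (w₁ y / w₁ x₁) (w₂ y / w₂ x₂) :=
      le_min (div_nonneg (hw₁0 y).le hW₁.le) (div_nonneg (hw₂0 y).le hW₂.le)
    have hm1 : min (w₁ y / w₁ x₁) (w₂ y / w₂ x₂) ≤ 1 :=
      (min_le_left _ _).trans ((div_le_one hW₁).2 (hmax₁ y))
    have hsub : {u : unitInterval | (u : ℝ) * 1 ≤ min (w₁ y / w₁ x₁) (w₂ y / w₂ x₂)} ⊆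
        Prod.mk y ⁻¹' ((fun p : Ω × unitInterval =>
          ((if (p.2 : ℝ) * w₁ z.1 ≤ w₁ p.1 then p.1 else z.1),
            (if (p.2 : ℝ) * w₂ z.2 ≤ w₂ p.1 then p.1 else z.2))) ⁻¹' C) := by
      intro u hu
      have hu0 : 0 ≤ (u : ℝ) := u.2.1
      simp only [mem_setOf_eq, mul_one] at hu
      have h1 : (u : ℝ) * w₁ z.1 ≤ w₁ y := by
        have := (le_min_iff.1 hu).1
        calc (u : ℝ) * w₁ z.1 ≤ (w₁ y / w₁ x₁) * w₁ x₁ :=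
              mul_le_mul this (hmax₁ z.1) (hw₁0 z.1).le (div_nonneg (hw₁0 y).le hW₁.le)
          _ = w₁ y := div_mul_cancel₀ _ hW₁.ne'
      have h2 : (u : ℝ) * w₂ z.2 ≤ w₂ y := by
        have := (le_min_iff.1 hu).2
        calc (u : ℝ) * w₂ z.2 ≤ (w₂ y / w₂ x₂) * w₂ x₂ :=
              mul_le_mul this (hmax₂ z.2) (hw₂0 z.2).le (div_nonneg (hw₂0 y).le hW₂.le)
          _ = w₂ y := div_mul_cancel₀ _ hW₂.ne'
      simp only [mem_preimage, if_pos h1, if_pos h2]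
      exact hy
    calc ENNReal.ofReal (min (w₁ y / w₁ x₁) (w₂ y / w₂ x₂))
        = ENNReal.ofReal (min 1 (min (w₁ y / w₁ x₁) (w₂ y / w₂ x₂) / 1)) := by
          rw [div_one, min_eq_right hm1]
      _ = (volume : Measure unitInterval) {u : unitInterval | (u : ℝ) * 1 ≤ min (w₁ y / w₁ x₁) (w₂ y / w₂ x₂)} :=
          (volume_unitInterval_mul_le one_pos hm0).symm
      _ ≤ _ := measure_mono hsub
  · rw [indicator_of_notMem hy]; exact bot_le

/-! ## §2 At every time: on one configuration with probability at least the overlap -/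

omit [IsProbabilityMeasure q] in
/-- **AT EVERY TIME, FROM EVERY JOINT LAW**: after one more shared update `P(Ẑ ∈ C) ≥ ν{y : (y, y) ∈ C}` — the pair law
`m K̂` dominates the diagonal lift of the overlap measure for every probability law `m` of the current pair. [ours] -/
theorem bind_crnTwoTarget_ge_overlap (hw₁ : Measurable w₁) (hw₂ : Measurable w₂) (hw₁0 : ∀ y, 0 < w₁ y)
    (hw₂0 : ∀ y, 0 < w₂ y) {x₁ x₂ : Ω} (hmax₁ : ∀ y, w₁ y ≤ w₁ x₁) (hmax₂ : ∀ y, w₂ y ≤ w₂ x₂)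
    (Khat : Kernel (Ω × Ω) (Ω × Ω)) [IsMarkovKernel Khat]
    (hK : ∀ z : Ω × Ω, Khat z = (q.prod (volume : Measure unitInterval)).map (fun p : Ω × unitInterval =>
      ((if (p.2 : ℝ) * w₁ z.1 ≤ w₁ p.1 then p.1 else z.1), (if (p.2 : ℝ) * w₂ z.2 ≤ w₂ p.1 then p.1 else z.2))))
    (m : Measure (Ω × Ω)) [IsProbabilityMeasure m] {C : Set (Ω × Ω)} (hC : MeasurableSet C) :
    (q.withDensity fun y => ENNReal.ofReal (min (w₁ y / w₁ x₁) (w₂ y / w₂ x₂))) {y | (y, y) ∈ C} ≤ (m.bind Khat) C := by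
  rw [Measure.bind_apply hC (Kernel.aemeasurable _)]
  calc (q.withDensity fun y => ENNReal.ofReal (min (w₁ y / w₁ x₁) (w₂ y / w₂ x₂))) {y | (y, y) ∈ C}
      = ∫⁻ _, (q.withDensity fun y => ENNReal.ofReal (min (w₁ y / w₁ x₁) (w₂ y / w₂ x₂))) {y | (y, y) ∈ C} ∂m := by
        rw [lintegral_const, measure_univ, mul_one]
    _ ≤ ∫⁻ z, Khat z C ∂m := lintegral_mono fun z => crnTwoTarget_ge_overlap hw₁ hw₂ hw₁0 hw₂0 hmax₁ hmax₂ Khat hK z hC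

omit [IsProbabilityMeasure q] in
/-- **EVERY OBSERVABLE READS THE SAME ON THE TWO RUNS WITH PROBABILITY AT LEAST THE OVERLAP** (diagonal-free): for a
measurable `g`, after any shared update from any joint law: `P(g(X) = g(X′)) ≥ ∫ min(w₁/w₁(x₁), w₂/w₂(x₂)) dq`.
[ours] -/
theorem bind_crnTwoTarget_observable_eq_ge (hw₁ : Measurable w₁) (hw₂ : Measurable w₂) (hw₁0 : ∀ y, 0 < w₁ y)
    (hw₂0 : ∀ y, 0 < w₂ y) {x₁ x₂ : Ω} (hmax₁ : ∀ y, w₁ y ≤ w₁ x₁) (hmax₂ : ∀ y, w₂ y ≤ w₂ x₂)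
    (Khat : Kernel (Ω × Ω) (Ω × Ω)) [IsMarkovKernel Khat]
    (hK : ∀ z : Ω × Ω, Khat z = (q.prod (volume : Measure unitInterval)).map (fun p : Ω × unitInterval =>
      ((if (p.2 : ℝ) * w₁ z.1 ≤ w₁ p.1 then p.1 else z.1), (if (p.2 : ℝ) * w₂ z.2 ≤ w₂ p.1 then p.1 else z.2))))
    (m : Measure (Ω × Ω)) [IsProbabilityMeasure m] {g : Ω → ℝ} (hg : Measurable g) :
    (∫⁻ y, ENNReal.ofReal (min (w₁ y / w₁ x₁) (w₂ y / w₂ x₂)) ∂q).toReal ≤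
      (m.bind Khat).real {p : Ω × Ω | g p.1 = g p.2} := by
  have hC : MeasurableSet {p : Ω × Ω | g p.1 = g p.2} :=
    measurableSet_eq_fun (hg.comp measurable_fst) (hg.comp measurable_snd)
  have h := bind_crnTwoTarget_ge_overlap hw₁ hw₂ hw₁0 hw₂0 hmax₁ hmax₂ Khat hK m hC
  have hset : {y : Ω | (y, y) ∈ {p : Ω × Ω | g p.1 = g p.2}} = univ := by ext y; simp
  rw [hset, withDensity_apply _ MeasurableSet.univ, Measure.restrict_univ] at h
  haveI : IsProbabilityMeasure (m.bind Khat) :=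
    ⟨by rw [Measure.bind_apply MeasurableSet.univ (Kernel.aemeasurable _)]; simp⟩
  exact ENNReal.toReal_mono (measure_ne_top _ _) h

omit [IsProbabilityMeasure q] in
/-- **`P(X = X′) ≥ overlap`** at every time (measurable diagonal). [ours] -/
theorem bind_crnTwoTarget_diagonal_ge [MeasurableEq Ω] (hw₁ : Measurable w₁) (hw₂ : Measurable w₂)
    (hw₁0 : ∀ y, 0 < w₁ y) (hw₂0 : ∀ y, 0 < w₂ y) {x₁ x₂ : Ω} (hmax₁ : ∀ y, w₁ y ≤ w₁ x₁)
    (hmax₂ : ∀ y, w₂ y ≤ w₂ x₂) (Khat : Kernel (Ω × Ω) (Ω × Ω)) [IsMarkovKernel Khat]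
    (hK : ∀ z : Ω × Ω, Khat z = (q.prod (volume : Measure unitInterval)).map (fun p : Ω × unitInterval =>
      ((if (p.2 : ℝ) * w₁ z.1 ≤ w₁ p.1 then p.1 else z.1), (if (p.2 : ℝ) * w₂ z.2 ≤ w₂ p.1 then p.1 else z.2))))
    (m : Measure (Ω × Ω)) [IsProbabilityMeasure m] :
    (∫⁻ y, ENNReal.ofReal (min (w₁ y / w₁ x₁) (w₂ y / w₂ x₂)) ∂q).toReal ≤ (m.bind Khat).real (Set.diagonal Ω) := by
  have h := bind_crnTwoTarget_ge_overlap hw₁ hw₂ hw₁0 hw₂0 hmax₁ hmax₂ Khat hK m measurableSet_diagonal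
  have hset : {y : Ω | (y, y) ∈ Set.diagonal Ω} = univ := by ext y; simp [Set.mem_diagonal_iff]
  rw [hset, withDensity_apply _ MeasurableSet.univ, Measure.restrict_univ] at h
  haveI : IsProbabilityMeasure (m.bind Khat) :=
    ⟨by rw [Measure.bind_apply MeasurableSet.univ (Kernel.aemeasurable _)]; simp⟩
  exact ENNReal.toReal_mono (measure_ne_top _ _) h

omit [IsProbabilityMeasure q] in
/-- **THE CRN FINITE-DIFFERENCE SPREAD**: for measurable `a ≤ g ≤ c`, after any shared update from any joint law,
`E|g(X) − g(X′)| ≤ (1 − ∫ min(w₁/w₁(x₁), w₂/w₂(x₂)) dq)·(c − a)`. [ours] -/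
theorem integral_bind_crnTwoTarget_abs_sub_le (hw₁ : Measurable w₁) (hw₂ : Measurable w₂) (hw₁0 : ∀ y, 0 < w₁ y)
    (hw₂0 : ∀ y, 0 < w₂ y) {x₁ x₂ : Ω} (hmax₁ : ∀ y, w₁ y ≤ w₁ x₁) (hmax₂ : ∀ y, w₂ y ≤ w₂ x₂)
    (Khat : Kernel (Ω × Ω) (Ω × Ω)) [IsMarkovKernel Khat]
    (hK : ∀ z : Ω × Ω, Khat z = (q.prod (volume : Measure unitInterval)).map (fun p : Ω × unitInterval =>
      ((if (p.2 : ℝ) * w₁ z.1 ≤ w₁ p.1 then p.1 else z.1), (if (p.2 : ℝ) * w₂ z.2 ≤ w₂ p.1 then p.1 else z.2))))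
    (m : Measure (Ω × Ω)) [IsProbabilityMeasure m] {g : Ω → ℝ} (hg : Measurable g) {a c : ℝ} (ha : ∀ x, a ≤ g x)
    (hc : ∀ x, g x ≤ c) :
    ∫ p, |g p.1 - g p.2| ∂(m.bind Khat) ≤
      (1 - (∫⁻ y, ENNReal.ofReal (min (w₁ y / w₁ x₁) (w₂ y / w₂ x₂)) ∂q).toReal) * (c - a) := by
  haveI : IsProbabilityMeasure (m.bind Khat) :=
    ⟨by rw [Measure.bind_apply MeasurableSet.univ (Kernel.aemeasurable _)]; simp⟩
  set P : Measure (Ω × Ω) := m.bind Khat with hP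
  have hE : MeasurableSet {p : Ω × Ω | g p.1 = g p.2} :=
    measurableSet_eq_fun (hg.comp measurable_fst) (hg.comp measurable_snd)
  have hca : 0 ≤ c - a := by have := ha x₁; have := hc x₁; linarith
  -- `|g − g′| ≤ (c − a)·1_{g ≠ g′}`
  have hpt : ∀ p : Ω × Ω, |g p.1 - g p.2| ≤ {p : Ω × Ω | g p.1 = g p.2}ᶜ.indicator (fun _ => c - a) p := by
    intro p
    by_cases hp : p ∈ {p : Ω × Ω | g p.1 = g p.2}
    · have : g p.1 = g p.2 := hp
      rw [indicator_of_notMem (by simpa using this), this, sub_self, abs_zero]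
    · rw [indicator_of_mem (by simpa using hp)]
      have h1 := ha p.1; have h2 := hc p.1; have h3 := ha p.2; have h4 := hc p.2
      exact abs_le.2 ⟨by linarith, by linarith⟩
  have hFm : Measurable (fun p : Ω × Ω => |g p.1 - g p.2|) := ((hg.comp measurable_fst).sub (hg.comp measurable_snd)).abs
  have hFi : Integrable (fun p : Ω × Ω => |g p.1 - g p.2|) P :=
    Summit.Ventures.LatticeQCDFlow.Scoring.integrable_of_bounded P hFm (C := c - a) (fun p => by
      rw [abs_abs]
      have h1 := ha p.1; have h2 := hc p.1; have h3 := ha p.2; have h4 := hc p.2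
      exact abs_le.2 ⟨by linarith, by linarith⟩)
  have hIi : Integrable ({p : Ω × Ω | g p.1 = g p.2}ᶜ.indicator (fun _ : Ω × Ω => c - a)) P :=
    (integrable_const (c - a)).indicator hE.compl
  have hov := bind_crnTwoTarget_observable_eq_ge hw₁ hw₂ hw₁0 hw₂0 hmax₁ hmax₂ Khat hK m hg
  calc ∫ p, |g p.1 - g p.2| ∂P ≤ ∫ p, {p : Ω × Ω | g p.1 = g p.2}ᶜ.indicator (fun _ => c - a) p ∂P :=
        integral_mono hFi hIi hpt
    _ = P.real {p : Ω × Ω | g p.1 = g p.2}ᶜ * (c - a) := by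
        rw [integral_indicator hE.compl, setIntegral_const, smul_eq_mul]
    _ = (1 - P.real {p : Ω × Ω | g p.1 = g p.2}) * (c - a) := by
        rw [measureReal_compl hE, probReal_univ]
    _ ≤ (1 - (∫⁻ y, ENNReal.ofReal (min (w₁ y / w₁ x₁) (w₂ y / w₂ x₂)) ∂q).toReal) * (c - a) := by
        apply mul_le_mul_of_nonneg_right _ hca
        linarith

end Summit.Ventures.LatticeQCDFlow.Exactness

end
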